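import Literature.RingTheory.FittingIdeal.Etale
import Mathlib.RingTheory.Localization.BaseChange
import Mathlib.RingTheory.Unramified.Basic
import HarnessLib

/-!
# Fitting ideals commute with localisation; the singular scheme `V(Fitt Ω)` localises (Stacks 07ZA, 00RT, 0C3H)

Topic: `Literature/RingTheory/FittingIdeal`. Consequences of the base change theorem
`Module.fittingIdeal_baseChange` (`BaseChange.lean`, Stacks 07ZA (3)) for LOCALISATIONS, in the
form needed to read a stalkwise invariant such as the length of `𝒪_{X,x}/Fitt_k(Ω_{𝒪_{X,x}/𝒪_{S,s}})`
(de Jong 1996, 2.21: `Sing(f)` is "the closed subscheme defined by the first Fitting ideal of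
the sheaf `Ω_{X/S}`"; `Scheme.Hom.nodeThickness` in `Literature/AlgebraicGeometry/Resolution`) on
an affine chart `Spec B → Spec A`, `x = 𝔭`, `s = 𝔮 = 𝔭 ∩ A`. All PROVED:

* `Module.fittingIdeal_of_isLocalizedModule` — **`Fitt_k(S⁻¹M) = S⁻¹ Fitt_k(M)`** for a finite
  `R`-module `M` and any localised module `M → S⁻¹M` over any localisation `R → S⁻¹R`
  (`IsLocalizedModule`; Stacks 07ZA (3) with `R' = S⁻¹R`, via `IsLocalizedModule.isBaseChange`).
  Localising the ALGEBRA `B` in `Ω_{B/A}` is the case `Ω_{S⁻¹B/A} = S⁻¹Ω_{B/A}` (Stacks 00RT (2)),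
  already in the tree as `Module.fittingIdeal_kaehlerDifferential_of_isLocalization'`
  (`Etale.lean`, localisations being formally étale);
* `KaehlerDifferential.linearEquivOfFormallyUnramifiedBase` and
  `Module.fittingIdeal_kaehlerDifferential_of_formallyUnramified_base` — **changing the base
  along a formally unramified map does nothing**: for `B` an algebra over a formally unramified
  `A`-algebra `A'` (a localisation `S⁻¹A` — Stacks 00RT (1): "`Ω_{B/A} = Ω_{B/S⁻¹A}`" — an étale
  `A`-algebra, a quotient, …), `Ω_{B/A} ≅ Ω_{B/A'}` (the exact
  `B ⊗ Ω_{A'/A} → Ω_{B/A} → Ω_{B/A'} → 0` with `Ω_{A'/A} = 0`), hence equal Fitting ideals; the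
  localisation case is `Module.fittingIdeal_kaehlerDifferential_isLocalization_base`;
* `Module.fittingIdeal_kaehlerDifferential_isLocalization_isLocalization` — both at once:
  `Fitt_k(Ω_{Bₘ/Aₙ}) = Fitt_k(Ω_{B/A}) Bₘ` for localisations `Aₙ` of `A` and `Bₘ` of `B` with
  `Aₙ → Bₘ` compatible (e.g. `B_𝔭` over `A_𝔮`): the stalk of the singular scheme is the singular
  scheme of the stalks.

## Sources

* The Stacks Project, Tag 07ZA (3) (Fitting ideals and base change), Tag 00RT = Lemma 10.131.8
  (differentials and localisation, of the algebra and of the base), Tag 0C3H (the singular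
  locus scheme of a curve via `Fitt₁ Ω`). [StacksProject]
* D. Eisenbud, *Commutative Algebra with a View Toward Algebraic Geometry*, GTM 150 (1995),
  Cor. 20.5; Prop. 16.9 (localisation of differentials). [Eisenbud1995]
-/

namespace Literature.RingTheory.FittingIdeal

universe u v w

open TensorProduct

/-! ## Fitting ideals of localised modules -/

/-- **Fitting ideals commute with localisation** (Stacks 07ZA (3) for `R' = S⁻¹R`; Eisenbud
Cor. 20.5): for a finite `R`-module `M`, a localisation `Rₛ` of `R` at `S` and a localised
module `f : M → Mₛ` at `S` over `Rₛ`, `Fitt_k(Mₛ) = Fitt_k(M) Rₛ` — `Mₛ ≅ Rₛ ⊗_R M`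
(`IsLocalizedModule.isBaseChange`) and `Module.fittingIdeal_baseChange`.
[cite: StacksProject, Tag 07ZA] -/
theorem Module.fittingIdeal_of_isLocalizedModule {R : Type u} [CommRing R] (S : Submonoid R)
    (Rₛ : Type v) [CommRing Rₛ] [Algebra R Rₛ] [IsLocalization S Rₛ]
    {M : Type w} [AddCommGroup M] [Module R M] [Module.Finite R M]
    {Mₛ : Type*} [AddCommGroup Mₛ] [Module R Mₛ] [Module Rₛ Mₛ] [IsScalarTower R Rₛ Mₛ]
    (f : M →ₗ[R] Mₛ) [IsLocalizedModule S f] (k : ℕ) :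
    Module.fittingIdeal Rₛ Mₛ k = (Module.fittingIdeal R M k).map (algebraMap R Rₛ) := by
  rw [← Module.fittingIdeal_eq_of_linearEquiv (IsLocalizedModule.isBaseChange S Rₛ f).equiv k,
    Module.fittingIdeal_baseChange]

/-! ## Differentials: changing the base along a formally unramified map -/

section Base

variable (A : Type u) [CommRing A] (A' : Type v) [CommRing A'] [Algebra A A']
  (B : Type w) [CommRing B] [Algebra A B] [Algebra A' B] [IsScalarTower A A' B]

/-- **Differentials do not see a formally unramified change of base** (Stacks 00RT (1) for a
localisation `A' = S⁻¹A`: "`Ω_{B/A} = Ω_{B/S⁻¹A}`"; equally for `A → A'` étale or surjective):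
for `B` an algebra over a formally unramified `A`-algebra `A'`, the natural map
`Ω_{B/A} → Ω_{B/A'}` is an isomorphism — it is surjective, and its kernel is the image of
`B ⊗_{A'} Ω_{A'/A}` (the exact sequence `B ⊗_{A'} Ω_{A'/A} → Ω_{B/A} → Ω_{B/A'} → 0`), which
vanishes as `Ω_{A'/A} = 0`. [cite: StacksProject, Tag 00RT] -/
noncomputable def KaehlerDifferential.linearEquivOfFormallyUnramifiedBase
    [Algebra.FormallyUnramified A A'] : Ω[B⁄A] ≃ₗ[B] Ω[B⁄A'] :=
  LinearEquiv.ofBijective (KaehlerDifferential.map A A' B B)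
    ⟨by
      -- `B ⊗ Ω_{A'/A} = 0`, so the first map of the exact sequence vanishes
      have h0 : ∀ y : B ⊗[A'] Ω[A'⁄A], KaehlerDifferential.mapBaseChange A A' B y = 0 := by
        intro y
        induction y using TensorProduct.induction_on with
        | zero => exact map_zero _
        | tmul b η => rw [Subsingleton.elim η 0, TensorProduct.tmul_zero, map_zero]
        | add y z hy hz => rw [map_add, hy, hz, add_zero]
      rw [injective_iff_map_eq_zero]
      intro ω hω
      obtain ⟨y, rfl⟩ := (KaehlerDifferential.exact_mapBaseChange_map A A' B ω).mp hω
      exact h0 y,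
      KaehlerDifferential.map_surjective A A' B⟩

/-- The isomorphism is the natural map `d_{B/A} b ↦ d_{B/A'} b`. [folklore] -/
@[simp]
theorem KaehlerDifferential.linearEquivOfFormallyUnramifiedBase_apply
    [Algebra.FormallyUnramified A A'] (ω : Ω[B⁄A]) :
    KaehlerDifferential.linearEquivOfFormallyUnramifiedBase A A' B ω =
      KaehlerDifferential.map A A' B B ω :=
  rfl

/-- **A formally unramified change of base does not change the singular scheme**:
`Fitt_k(Ω_{B/A'}) = Fitt_k(Ω_{B/A})` for `B` over a formally unramified `A`-algebra `A'`
(`Ω_{B/A'} ≅ Ω_{B/A}`, and Fitting ideals are invariants of the module).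
[cite: StacksProject, Tag 00RT] -/
theorem Module.fittingIdeal_kaehlerDifferential_of_formallyUnramified_base
    [Algebra.FormallyUnramified A A'] (k : ℕ) :
    Module.fittingIdeal B (Ω[B⁄A']) k = Module.fittingIdeal B (Ω[B⁄A]) k :=
  (Module.fittingIdeal_eq_of_linearEquiv
    (KaehlerDifferential.linearEquivOfFormallyUnramifiedBase A A' B) k).symm

/-- **Localising the base does not change the singular scheme** (Stacks 00RT (1):
"`Ω_{B/A} = Ω_{B/S⁻¹A}`"): `Fitt_k(Ω_{B/S⁻¹A}) = Fitt_k(Ω_{B/A})`, a localisation being formally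
unramified. [cite: StacksProject, Tag 00RT] -/
theorem Module.fittingIdeal_kaehlerDifferential_isLocalization_base (N : Submonoid A)
    [IsLocalization N A'] (k : ℕ) :
    Module.fittingIdeal B (Ω[B⁄A']) k = Module.fittingIdeal B (Ω[B⁄A]) k :=
  haveI : Algebra.FormallyUnramified A A' := Algebra.FormallyUnramified.of_isLocalization N
  Module.fittingIdeal_kaehlerDifferential_of_formallyUnramified_base A A' B k

end Base

/-! ## Both at once: the stalks of the singular scheme -/

/-- **The singular scheme of the stalks is the stalk of the singular scheme**: for an
`A`-algebra `B` with `Ω_{B/A}` finite, localisations `Aₙ` of `A` and `Bₘ` of `B`, and a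
compatible algebra structure `Aₙ → Bₘ` (e.g. `A_𝔮 → B_𝔭` for a prime `𝔭 ⊂ B` over `𝔮 ⊂ A`):
`Fitt_k(Ω_{Bₘ/Aₙ}) = Fitt_k(Ω_{B/A}) Bₘ` (Stacks 00RT (1) and (2) with 07ZA (3)). In particular
the length of `Bₘ/Fitt_k(Ω_{Bₘ/Aₙ})` — for `k = 1` and a relative curve the thickness of de Jong
1996, 3.4 — is computed by the global Jacobian/Fitting ideal of `B` over `A`.
[cite: StacksProject, Tag 07ZA] -/
theorem Module.fittingIdeal_kaehlerDifferential_isLocalization_isLocalization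
    {A : Type u} [CommRing A] (N : Submonoid A) (Aₙ : Type v) [CommRing Aₙ] [Algebra A Aₙ]
    [IsLocalization N Aₙ] {B : Type w} {Bₘ : Type*} [CommRing B] [CommRing Bₘ] [Algebra A B]
    [Algebra A Bₘ] [Algebra B Bₘ] [IsScalarTower A B Bₘ] (M : Submonoid B) [IsLocalization M Bₘ]
    [Algebra Aₙ Bₘ] [IsScalarTower A Aₙ Bₘ] [Module.Finite B (Ω[B⁄A])] (k : ℕ) :
    Module.fittingIdeal Bₘ (Ω[Bₘ⁄Aₙ]) k =
      (Module.fittingIdeal B (Ω[B⁄A]) k).map (algebraMap B Bₘ) := by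
  rw [Module.fittingIdeal_kaehlerDifferential_isLocalization_base A Aₙ Bₘ N,
    Module.fittingIdeal_kaehlerDifferential_of_isLocalization' M]

end Literature.RingTheory.FittingIdeal
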